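import Literature.NumberTheory.Sieve.DrappeauDispersionOrthogonality
import Literature.NumberTheory.Sieve.BombieriVinogradovFacts
import HarnessLib

/-!
# Drappeau 2017, §5.6: the kernel `𝔲_R` over primitive characters; bilinear expansion and positivity — proved

S. Drappeau, *Sums of Kloosterman sums in arithmetic progressions, and the error term in the
dispersion method*, Proc. London Math. Soc. (3) 114 (2017) 684–732 = arXiv:1504.05549
(`Drappeau2017`; held as `paper:arxiv-1504.05549`, §5.6 read on chunk 21).

Second brick (after `…DrappeauDispersionOrthogonality`) of the printed proof of **Theorem 5.1**
(`Literature.NumberTheory.Sieve.Drappeau2017_theorem51`).  In §5.6 ("The main terms") the two main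
terms of the dispersion combine into
`X₁ − X₃ = ∑_{q₁,q₂} γ(q₁)γ(q₂)/[q₁,q₂] ∑_{n₁,n₂} β̄_{n₁} β_{n₂} 𝔲_R(n₁ n̄₂; (q₁, q₂))` ((5.21)),
which is then bounded by the multiplicative large sieve after "We insert the definition of `𝔲_R`
in the form `𝔲_R(n₁ n̄₂; (q₁,q₂)) = φ((q₁,q₂))⁻¹ ∑_{χ primitive, cond χ > R, cond χ ∣ (q₁,q₂)}
χ(n̄₁) χ(n₂)`" (p. 21).  This file proves the algebraic part of that step for one modulus `s`:

* `sum_univ_eq_sum_primIndex` — the characters `mod s` are in bijection with the tree's index set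
  `primIndex s = {(f, ψ) : f ∣ s, ψ primitive mod f}` through `induce s` (`image_induce_primIndex`
  of the tree plus injectivity, `induce_injOn_primIndex`), with `cond (induce s (f, ψ)) = f`
  (`conductor_induce`);
* `uR_eq_sum_primIndex` — the displayed form of the kernel:
  `𝔲_R(t; s) = φ(s)⁻¹ ∑_{(f,ψ) ∈ primIndex s, f > R} ψ_s(t)`, `ψ_s` the character `mod s` induced by `ψ`;
* `sum_sum_mul_uR_eq` — the **bilinear expansion**: for `n₁` ranging over integers coprime to `s`,
  `∑_{n₁,n₂} u(n₁) v(n₂) 𝔲_R(n̄₁ n₂; s) = φ(s)⁻¹ ∑_{χ mod s, cond χ > R} (∑ u(n₁) χ(n₁)⁻¹)(∑ v(n₂) χ(n₂))`;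
* `sum_sum_conj_mul_uR_eq` — **positivity** of the form in (5.21): with `u = ā`, `v = a`,
  `∑_{n₁,n₂} ā(n₁) a(n₂) 𝔲_R(n̄₁ n₂; s) = φ(s)⁻¹ ∑_{cond χ > R} ‖∑_n a(n) χ(n)‖²` (real, `≥ 0`);
* `norm_sum_sum_mul_uR_le` — the triangle-inequality form over PRIMITIVE characters, which is what
  the large sieve (`Literature.NumberTheory.Sieve.LargeSieve.largeSieve_character_nat`) consumes:
  `‖∑∑ u v 𝔲_R‖ ≤ φ(s)⁻¹ ∑_{(f,ψ) ∈ primIndex s, f > R} ‖∑ u(n₁) ψ(n₁)⁻¹‖ ‖∑ v(n₂) ψ(n₂)‖`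
  (for `n₁, n₂` coprime to `s`, where `ψ_s(n) = ψ(n)`).

Not here: the Möbius separation of `(nⱼ, qⱼ) = 1`, the `q₁, q₂`-summation `O(1/(r²d₁d₂))`, the
bound `φ(q) ≫ q/log log q` and the partial summation against the large sieve (the analytic half of
§5.6), Theorem 5.1 itself.

## References

* S. Drappeau, Proc. London Math. Soc. (3) 114 (2017) 684–732, arXiv:1504.05549, §5 (5.1),
  §5.6 (5.21). [Drappeau2017]
-/

noncomputable section

open Finset DirichletCharacter

namespace Literature.NumberTheory.Sieve

namespace Drappeau2017

/-! ### Characters `mod s` ↔ `primIndex s` -/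

/-- The character `mod s` induced by `(f, ψ) ∈ primIndex s` has conductor `f`. [folklore] -/
theorem conductor_induce {s : ℕ} [NeZero s] {p : Σ f : ℕ, DirichletCharacter ℂ f}
    (hp : p ∈ primIndex s) : (induce s p).conductor = p.1 := by
  obtain ⟨hdvd, -, hprim⟩ := mem_primIndex.1 hp
  rw [induce, dif_pos hdvd, conductor_changeLevel]
  exact hprim

/-- `induce s` is injective on `primIndex s` (`s ≠ 0`): the conductor recovers `f`, and
`changeLevel` is injective. [folklore] -/
theorem induce_injOn_primIndex (s : ℕ) [NeZero s] : Set.InjOn (induce s) (primIndex s) := by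
  intro p hp p' hp' h
  have hp1 := mem_primIndex.1 (Finset.mem_coe.1 hp)
  have hp'1 := mem_primIndex.1 (Finset.mem_coe.1 hp')
  have hf : p.1 = p'.1 := by
    rw [← conductor_induce (Finset.mem_coe.1 hp), ← conductor_induce (Finset.mem_coe.1 hp'), h]
  obtain ⟨f, ψ⟩ := p
  obtain ⟨f', ψ'⟩ := p'
  simp only at hf
  subst hf
  have hψ : ψ = ψ' := by
    rw [induce, dif_pos hp1.1, induce, dif_pos hp'1.1] at h
    exact changeLevel_injective hp1.1 h
  rw [hψ]

/-- **Reindexing by primitive characters**: `∑_{χ mod s} G(χ) = ∑_{(f,ψ) ∈ primIndex s} G(ψ_s)`,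
`ψ_s = induce s (f, ψ)` (every character is induced by exactly one primitive character).
[folklore] -/
theorem sum_univ_eq_sum_primIndex {M : Type*} [AddCommMonoid M] (s : ℕ) [NeZero s]
    (G : DirichletCharacter ℂ s → M) : ∑ χ, G χ = ∑ p ∈ primIndex s, G (induce s p) := by
  classical
  rw [← image_induce_primIndex s, Finset.sum_image (induce_injOn_primIndex s)]

/-- The same for a sum restricted by a condition on the conductor:
`∑_{χ mod s, P(cond χ)} G(χ) = ∑_{(f,ψ) ∈ primIndex s, P(f)} G(ψ_s)`. [folklore] -/
theorem sum_filter_conductor_eq_sum_primIndex {M : Type*} [AddCommMonoid M] (s : ℕ) [NeZero s]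
    (P : ℕ → Prop) [DecidablePred P] (G : DirichletCharacter ℂ s → M) :
    ∑ χ ∈ univ.filter (fun χ : DirichletCharacter ℂ s => P χ.conductor), G χ =
      ∑ p ∈ (primIndex s).filter (fun p => P p.1), G (induce s p) := by
  classical
  rw [Finset.sum_filter, Finset.sum_filter, sum_univ_eq_sum_primIndex]
  refine Finset.sum_congr rfl fun p hp => ?_
  rw [conductor_induce hp]

/-- For `n` coprime to `s`, the induced character takes the value of the primitive one:
`ψ_s(n) = ψ(n)`. [folklore] -/
theorem induce_apply_intCast {s : ℕ} {p : Σ f : ℕ, DirichletCharacter ℂ f} (hp : p ∈ primIndex s)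
    {n : ℤ} (hn : IsCoprime n s) : induce s p (n : ZMod s) = p.2 (n : ZMod p.1) := by
  obtain ⟨hdvd, -, -⟩ := mem_primIndex.1 hp
  rw [induce, dif_pos hdvd, changeLevel_eq_cast_of_dvd' _ _ hn]

/-! ### The kernel over primitive characters ((5.1), §5.6) -/

/-- **`𝔲_R` over primitive characters** (Drappeau §5.6: "`𝔲_R(·; q) = φ(q)⁻¹ ∑_{χ primitive,
cond χ > R, cond χ ∣ q} χ(·)`", the characters read `mod q`): for `s ≠ 0`,
`𝔲_R(t; s) = φ(s)⁻¹ ∑_{(f,ψ) ∈ primIndex s, f > R} ψ_s(t)`. [cite: Drappeau2017, §5 (5.1), §5.6] -/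
theorem uR_eq_sum_primIndex (R : ℝ) (s : ℕ) [NeZero s] (t : ZMod s) :
    uR R s t = ((Nat.totient s : ℂ))⁻¹ *
      ∑ p ∈ (primIndex s).filter (fun p => R < (p.1 : ℝ)), induce s p t := by
  classical
  unfold uR
  congr 1
  rw [← Finset.sum_filter]
  exact sum_filter_conductor_eq_sum_primIndex s (fun f => R < (f : ℝ)) (fun χ => χ t)

/-! ### Bilinear expansion and positivity ((5.21)) -/

/-- **Bilinear expansion of the `𝔲_R`-form** (the structure behind (5.21)): for finite sets of
integers `T₁, T₂` with every `n₁ ∈ T₁` coprime to `s ≠ 0`, and any weights `u, v`,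
`∑_{n₁ ∈ T₁} ∑_{n₂ ∈ T₂} u(n₁) v(n₂) 𝔲_R(n̄₁ n₂; s)
  = φ(s)⁻¹ ∑_{χ mod s, cond χ > R} (∑_{n₁} u(n₁) χ(n₁)⁻¹) (∑_{n₂} v(n₂) χ(n₂))`.
[cite: Drappeau2017, §5.6 (5.21)] -/
theorem sum_sum_mul_uR_eq (R : ℝ) (s : ℕ) [NeZero s] (T₁ T₂ : Finset ℤ) (u v : ℤ → ℂ)
    (hT₁ : ∀ n ∈ T₁, IsCoprime n s) :
    ∑ n₁ ∈ T₁, ∑ n₂ ∈ T₂, u n₁ * v n₂ * uR R s ((n₁ : ZMod s)⁻¹ * (n₂ : ZMod s)) =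
      ((Nat.totient s : ℂ))⁻¹ *
        ∑ χ ∈ univ.filter (fun χ : DirichletCharacter ℂ s => R < (χ.conductor : ℝ)),
          (∑ n₁ ∈ T₁, u n₁ * (χ (n₁ : ZMod s))⁻¹) * (∑ n₂ ∈ T₂, v n₂ * χ (n₂ : ZMod s)) := by
  classical
  -- expand the kernel and the character values `χ(n̄₁ n₂) = χ(n₁)⁻¹ χ(n₂)`
  have hexp : ∀ n₁ ∈ T₁, ∀ n₂ ∈ T₂,
      u n₁ * v n₂ * uR R s ((n₁ : ZMod s)⁻¹ * (n₂ : ZMod s)) =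
        ((Nat.totient s : ℂ))⁻¹ *
          ∑ χ ∈ univ.filter (fun χ : DirichletCharacter ℂ s => R < (χ.conductor : ℝ)),
            (u n₁ * (χ (n₁ : ZMod s))⁻¹) * (v n₂ * χ (n₂ : ZMod s)) := by
    intro n₁ hn₁ n₂ _
    have hu : IsUnit ((n₁ : ℤ) : ZMod s) := (ZMod.coe_int_isUnit_iff_isCoprime n₁ s).2 (hT₁ n₁ hn₁).symm
    unfold uR
    rw [← Finset.sum_filter, Finset.mul_sum, Finset.mul_sum, Finset.mul_sum]
    refine Finset.sum_congr rfl fun χ _ => ?_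
    rw [map_mul, apply_inv_of_isUnit χ hu]
    ring
  rw [Finset.sum_congr rfl fun n₁ hn₁ => Finset.sum_congr rfl fun n₂ hn₂ => hexp n₁ hn₁ n₂ hn₂]
  -- expand the products, swap the sums, distribute the constant
  symm
  calc ((Nat.totient s : ℂ))⁻¹ *
        ∑ χ ∈ univ.filter (fun χ : DirichletCharacter ℂ s => R < (χ.conductor : ℝ)),
          (∑ n₁ ∈ T₁, u n₁ * (χ (n₁ : ZMod s))⁻¹) * (∑ n₂ ∈ T₂, v n₂ * χ (n₂ : ZMod s))
      = ((Nat.totient s : ℂ))⁻¹ *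
        ∑ χ ∈ univ.filter (fun χ : DirichletCharacter ℂ s => R < (χ.conductor : ℝ)),
          ∑ n₁ ∈ T₁, ∑ n₂ ∈ T₂, (u n₁ * (χ (n₁ : ZMod s))⁻¹) * (v n₂ * χ (n₂ : ZMod s)) := by
        congr 1
        refine Finset.sum_congr rfl fun χ _ => ?_
        rw [Finset.sum_mul_sum]
    _ = ((Nat.totient s : ℂ))⁻¹ * ∑ n₁ ∈ T₁, ∑ n₂ ∈ T₂,
        ∑ χ ∈ univ.filter (fun χ : DirichletCharacter ℂ s => R < (χ.conductor : ℝ)),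
          (u n₁ * (χ (n₁ : ZMod s))⁻¹) * (v n₂ * χ (n₂ : ZMod s)) := by
        congr 1
        rw [Finset.sum_comm]
        refine Finset.sum_congr rfl fun n₁ _ => ?_
        rw [Finset.sum_comm]
    _ = ∑ n₁ ∈ T₁, ∑ n₂ ∈ T₂, ((Nat.totient s : ℂ))⁻¹ *
        ∑ χ ∈ univ.filter (fun χ : DirichletCharacter ℂ s => R < (χ.conductor : ℝ)),
          (u n₁ * (χ (n₁ : ZMod s))⁻¹) * (v n₂ * χ (n₂ : ZMod s)) := by
        rw [Finset.mul_sum]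
        refine Finset.sum_congr rfl fun n₁ _ => ?_
        rw [Finset.mul_sum]

/-- **Positivity of the `𝔲_R`-form** ((5.21) with `β̄_{n₁} β_{n₂}`): for a finite set `T` of
integers coprime to `s ≠ 0` and any weights `a`,
`∑_{n₁,n₂ ∈ T} ā(n₁) a(n₂) 𝔲_R(n̄₁ n₂; s) = φ(s)⁻¹ ∑_{χ mod s, cond χ > R} ‖∑_{n ∈ T} a(n) χ(n)‖²`;
in particular the left side is a nonnegative real number. [cite: Drappeau2017, §5.6 (5.21)] -/
theorem sum_sum_conj_mul_uR_eq (R : ℝ) (s : ℕ) [NeZero s] (T : Finset ℤ) (a : ℤ → ℂ)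
    (hT : ∀ n ∈ T, IsCoprime n s) :
    ∑ n₁ ∈ T, ∑ n₂ ∈ T, starRingEnd ℂ (a n₁) * a n₂ * uR R s ((n₁ : ZMod s)⁻¹ * (n₂ : ZMod s)) =
      ((((Nat.totient s : ℝ))⁻¹ *
        ∑ χ ∈ univ.filter (fun χ : DirichletCharacter ℂ s => R < (χ.conductor : ℝ)),
          ‖∑ n ∈ T, a n * χ (n : ZMod s)‖ ^ 2 : ℝ) : ℂ) := by
  classical
  rw [sum_sum_mul_uR_eq R s T T (fun n => starRingEnd ℂ (a n)) a hT]
  push_cast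
  congr 1
  refine Finset.sum_congr rfl fun χ _ => ?_
  have hconj : ∑ n₁ ∈ T, starRingEnd ℂ (a n₁) * (χ (n₁ : ZMod s))⁻¹ =
      starRingEnd ℂ (∑ n ∈ T, a n * χ (n : ZMod s)) := by
    rw [map_sum]
    refine Finset.sum_congr rfl fun n _ => ?_
    rw [map_mul, conj_apply_eq_inv]
  rw [hconj, Complex.conj_mul']

/-- The `𝔲_R`-form `∑∑ ā(n₁) a(n₂) 𝔲_R(n̄₁ n₂; s)` is a nonnegative real (its real part is `≥ 0`
and it equals its real part). [cite: Drappeau2017, §5.6 (5.21)] -/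
theorem sum_sum_conj_mul_uR_nonneg (R : ℝ) (s : ℕ) [NeZero s] (T : Finset ℤ) (a : ℤ → ℂ)
    (hT : ∀ n ∈ T, IsCoprime n s) :
    0 ≤ (∑ n₁ ∈ T, ∑ n₂ ∈ T,
      starRingEnd ℂ (a n₁) * a n₂ * uR R s ((n₁ : ZMod s)⁻¹ * (n₂ : ZMod s))).re := by
  rw [sum_sum_conj_mul_uR_eq R s T a hT, Complex.ofReal_re]
  refine mul_nonneg (inv_nonneg.2 (Nat.cast_nonneg _)) (Finset.sum_nonneg fun χ _ => ?_)
  positivity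

/-! ### The triangle-inequality form over primitive characters -/

/-- **The `𝔲_R`-form bounded through primitive characters** (the form in which §5.6 feeds
`X₁ − X₃` to the multiplicative large sieve, after (5.21)): for finite sets `T₁, T₂` of integers
coprime to `s ≠ 0` and weights `u, v`,
`‖∑_{n₁ ∈ T₁} ∑_{n₂ ∈ T₂} u(n₁) v(n₂) 𝔲_R(n̄₁ n₂; s)‖
  ≤ φ(s)⁻¹ ∑_{(f,ψ) ∈ primIndex s, f > R} ‖∑_{n₁} u(n₁) ψ(n₁)⁻¹‖ · ‖∑_{n₂} v(n₂) ψ(n₂)‖`,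
the primitive characters `ψ mod f` being evaluated directly at `n ∈ Tⱼ` (legitimate as
`(n, s) = 1`). [cite: Drappeau2017, §5.6] -/
theorem norm_sum_sum_mul_uR_le (R : ℝ) (s : ℕ) [NeZero s] (T₁ T₂ : Finset ℤ) (u v : ℤ → ℂ)
    (hT₁ : ∀ n ∈ T₁, IsCoprime n s) (hT₂ : ∀ n ∈ T₂, IsCoprime n s) :
    ‖∑ n₁ ∈ T₁, ∑ n₂ ∈ T₂, u n₁ * v n₂ * uR R s ((n₁ : ZMod s)⁻¹ * (n₂ : ZMod s))‖ ≤
      ((Nat.totient s : ℝ))⁻¹ *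
        ∑ p ∈ (primIndex s).filter (fun p => R < (p.1 : ℝ)),
          ‖∑ n₁ ∈ T₁, u n₁ * (p.2 (n₁ : ZMod p.1))⁻¹‖ * ‖∑ n₂ ∈ T₂, v n₂ * p.2 (n₂ : ZMod p.1)‖ := by
  classical
  rw [sum_sum_mul_uR_eq R s T₁ T₂ u v hT₁,
    sum_filter_conductor_eq_sum_primIndex s (fun f => R < (f : ℝ))]
  -- evaluate the induced characters at the coprime arguments
  have hval : ∀ p ∈ (primIndex s).filter (fun p => R < (p.1 : ℝ)),
      (∑ n₁ ∈ T₁, u n₁ * (induce s p (n₁ : ZMod s))⁻¹) * (∑ n₂ ∈ T₂, v n₂ * induce s p (n₂ : ZMod s)) =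
      (∑ n₁ ∈ T₁, u n₁ * (p.2 (n₁ : ZMod p.1))⁻¹) * (∑ n₂ ∈ T₂, v n₂ * p.2 (n₂ : ZMod p.1)) := by
    intro p hp
    have hp' := (Finset.mem_filter.1 hp).1
    congr 1
    · refine Finset.sum_congr rfl fun n₁ hn₁ => ?_
      rw [induce_apply_intCast hp' (hT₁ n₁ hn₁)]
    · refine Finset.sum_congr rfl fun n₂ hn₂ => ?_
      rw [induce_apply_intCast hp' (hT₂ n₂ hn₂)]
  rw [Finset.sum_congr rfl hval, norm_mul, norm_inv, Complex.norm_natCast]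
  refine mul_le_mul_of_nonneg_left ?_ (inv_nonneg.2 (Nat.cast_nonneg _))
  refine (norm_sum_le _ _).trans (Finset.sum_le_sum fun p _ => ?_)
  rw [norm_mul]

end Drappeau2017

end Literature.NumberTheory.Sieve

end
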